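import Mathlib
import Literature.NumberTheory.DiophantineGeometry.BelyiLemmaProofs

/-!
# Noncritical Belyi maps on `ℙ¹`, step IV-b: the normalising Möbius transformation

Scherr–Zieve [cite: ScherrZieve2014], Lemma 6 / Mochizuki [NCBelyi] Lemma 2.3: before the
degree-lowering step one applies a fractional linear transformation over `ℚ` that separates the
protected point from the finite set `A` (there: by archimedean size).  In the `p`-adic variant
formalised in this directory the transformation must achieve: the protected point `∞` goes to a
rational `b₀` with `|b₀|_p > 1`, while `A` goes to ALGEBRAIC INTEGERS of degree `< p` (the
hypotheses of `NoncriticalBelyi.core`).  This file constructs it (`NoncriticalBelyi.normalize`):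

  `μ(x) = b₀ · x/(x + c)`, `b₀ = L'/p`, `c = L/p`,

where `L ∈ ℤ ∖ 0` makes every `L/a` (`a ∈ A ∖ 0`) an algebraic integer, `p` is a prime exceeding
the degrees of the points of `A` and the constant coefficients `c₀(a₂)` of the minimal polynomials
of the `a₂ := L/a`, and `L' := Π_{a₂} m_{a₂}(−p)` (so `p ∤ L'`, and
`m_{a₂}(−p)/(a₂ + p) = −(m_{a₂} /ₘ (x + p))(a₂)` is integral); then `μ(a) = L'/(a₂ + p)` is an
algebraic integer and `μ(0) = 0`.  No definitions, no named facts.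
-/

namespace Literature.NumberTheory.DiophantineGeometry

open Polynomial Finset IntermediateField

namespace NoncriticalBelyi

/-- A finite set of algebraic numbers has a common nonzero integer multiplier making all of them
algebraic integers. [folklore] -/
private theorem exists_common_multiple (X : Finset ℂ) (hX : ∀ x ∈ X, IsAlgebraic ℚ x) :
    ∃ L : ℤ, L ≠ 0 ∧ ∀ x ∈ X, IsIntegral ℤ ((L : ℂ) * x) := by
  classical
  induction X using Finset.induction_on with
  | empty => exact ⟨1, one_ne_zero, by simp⟩
  | insert x s hx ih =>
    obtain ⟨L, hL0, hL⟩ := ih fun y hy => hX y (mem_insert_of_mem hy)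
    have hxZ : IsAlgebraic ℤ x :=
      (IsFractionRing.isAlgebraic_iff ℤ ℚ ℂ).2 (hX x (mem_insert_self _ _))
    obtain ⟨y, hy0, hy⟩ := hxZ.exists_integral_multiple
    refine ⟨y * L, mul_ne_zero hy0 hL0, fun t ht => ?_⟩
    rcases mem_insert.1 ht with rfl | ht
    · have : ((y * L : ℤ) : ℂ) * t = (L : ℂ) * (y • t) := by rw [zsmul_eq_mul]; push_cast; ring
      rw [this]; exact isIntegral_algebraMap.mul hy
    · have : ((y * L : ℤ) : ℂ) * t = (y : ℂ) * ((L : ℂ) * t) := by push_cast; ring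
      rw [this]; exact isIntegral_algebraMap.mul (hL t ht)

/-- Degrees over `ℚ` do not increase inside `ℚ(x)`: if `s ∈ ℚ(x)` then `deg_ℚ s ≤ deg_ℚ x`.
[folklore] -/
private theorem natDegree_minpoly_le_of_mem_adjoin {x s : ℂ} (hx : IsIntegral ℚ x)
    (hs : s ∈ ℚ⟮x⟯) : (minpoly ℚ s).natDegree ≤ (minpoly ℚ x).natDegree := by
  haveI := IntermediateField.adjoin.finiteDimensional hx
  set y : ℚ⟮x⟯ := ⟨s, hs⟩ with hy
  have h1 : minpoly ℚ s = minpoly ℚ y := by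
    have := minpoly.algebraMap_eq (A := ℚ) (algebraMap ℚ⟮x⟯ ℂ).injective y
    simpa [hy] using this
  rw [h1, ← IntermediateField.adjoin.finrank hx]
  exact minpoly.natDegree_le y

/-- For an algebraic integer `a` with integral minimal polynomial `m` and an integer `n`: if
`m(−n) ≠ 0` then `a + n ≠ 0` and `m(−n)/(a + n) = −(m /ₘ (x + n))(a)` is an algebraic integer.
[folklore] -/
private theorem isIntegral_eval_div {a : ℂ} (ha : IsIntegral ℤ a) (n : ℤ)
    (hr : (minpoly ℤ a).eval (-n) ≠ 0) :
    a + (n : ℂ) ≠ 0 ∧ IsIntegral ℤ ((((minpoly ℤ a).eval (-n) : ℤ) : ℂ) / (a + (n : ℂ))) := by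
  set m : ℤ[X] := minpoly ℤ a with hm
  set Q : ℤ[X] := m /ₘ (X - C (-n)) with hQ
  have hdiv : C (m.eval (-n)) + (X - C (-n)) * Q = m := by
    rw [← modByMonic_X_sub_C_eq_C_eval]; exact modByMonic_add_div m _
  have hev := congrArg (aeval a) hdiv
  rw [map_add, map_mul, aeval_C, map_sub, aeval_X, aeval_C, hm, minpoly.aeval] at hev
  simp only [algebraMap_int_eq, Int.coe_castRingHom, Int.cast_neg, sub_neg_eq_add] at hev
  -- `hev : m(-n) + (a + n) * Q(a) = 0`
  have han : a + (n : ℂ) ≠ 0 := by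
    intro h
    rw [h, zero_mul, add_zero] at hev
    exact hr (by exact_mod_cast hev)
  refine ⟨han, ?_⟩
  have hval : (((minpoly ℤ a).eval (-n) : ℤ) : ℂ) / (a + (n : ℂ)) = -aeval a Q := by
    rw [div_eq_iff han, ← hm]
    linear_combination hev
  rw [hval]
  exact (IsIntegral.of_mem_of_fg _ ha.fg_adjoin_singleton _ (aeval_mem_adjoin_singleton _ _)).neg

/-- **The normalising Möbius map** (Scherr–Zieve Lemma 6 / [NCBelyi] Lem. 2.3, `p`-adic form).
For a finite set `A` of algebraic numbers there are a prime `p` and rationals `b₀ ≠ 0`, `c ≠ 0` with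
`|b₀|_p > 1` such that `μ(x) = b₀ x/(x + c)` has no pole on `A` and maps every `a ∈ A` to an
algebraic INTEGER of degree `< p` over `ℚ` (and `μ(∞) = b₀`).
[cite: ScherrZieve2014, Lemma 6] -/
theorem normalize (A : Finset ℂ) (hA : ∀ a ∈ A, IsAlgebraic ℚ a) :
    ∃ (p : ℕ) (_ : Fact p.Prime) (b₀ c : ℚ), 1 < padicNorm p b₀ ∧ b₀ ≠ 0 ∧ c ≠ 0 ∧
      ∀ a ∈ A, a + algebraMap ℚ ℂ c ≠ 0 ∧
        IsIntegral ℤ (algebraMap ℚ ℂ b₀ * a / (a + algebraMap ℚ ℂ c)) ∧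
        (minpoly ℚ (algebraMap ℚ ℂ b₀ * a / (a + algebraMap ℚ ℂ c))).natDegree < p := by
  classical
  -- `L`: common multiplier making the `1/a`, `a ∈ A ∖ 0`, integral
  set A₀ : Finset ℂ := A.filter fun a => a ≠ 0 with hA₀
  obtain ⟨L, hL0, hL⟩ := exists_common_multiple (A₀.image fun a => a⁻¹) (by
    intro x hx
    obtain ⟨a, ha, rfl⟩ := mem_image.1 hx
    exact (hA a (mem_filter.1 ha).1).inv)
  have hLint : ∀ a ∈ A, a ≠ 0 → IsIntegral ℤ ((L : ℂ) * a⁻¹) :=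
    fun a ha ha0 => hL _ (mem_image.2 ⟨a, mem_filter.2 ⟨ha, ha0⟩, rfl⟩)
  -- `A₂ = {L/a}`
  set A₂ : Finset ℂ := A₀.image fun a => (L : ℂ) * a⁻¹ with hA₂
  have hA₂int : ∀ a₂ ∈ A₂, IsIntegral ℤ a₂ ∧ a₂ ≠ 0 := by
    intro a₂ h
    obtain ⟨a, ha, rfl⟩ := mem_image.1 h
    obtain ⟨haA, ha0⟩ := mem_filter.1 ha
    exact ⟨hLint a haA ha0, mul_ne_zero (Int.cast_ne_zero.2 hL0) (inv_ne_zero ha0)⟩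
  -- constant coefficients of the minimal polynomials over `ℤ`
  have hc₀ : ∀ a₂ ∈ A₂, (minpoly ℤ a₂).coeff 0 ≠ 0 := by
    intro a₂ h
    obtain ⟨hint, hne⟩ := hA₂int a₂ h
    have hQ := minpoly.coeff_zero_ne_zero (hint.tower_top (A := ℚ)) hne
    rw [minpoly.isIntegrallyClosed_eq_field_fractions' ℚ hint, coeff_map] at hQ
    exact fun h0 => hQ (by rw [h0, map_zero])
  -- the prime `p`
  set D : ℕ := A.sup fun a => (minpoly ℚ a).natDegree with hD
  set M : ℕ := A₂.sup fun a₂ => ((minpoly ℤ a₂).coeff 0).natAbs with hM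
  obtain ⟨p, hpge, hp⟩ := Nat.exists_infinite_primes (D + M + 2)
  haveI : Fact p.Prime := ⟨hp⟩
  have hpZ : Prime (p : ℤ) := Nat.prime_iff_prime_int.1 hp
  have hpdvd : ∀ a₂ ∈ A₂, ¬ (p : ℤ) ∣ (minpoly ℤ a₂).coeff 0 := by
    intro a₂ h hdvd
    have h1 : ((minpoly ℤ a₂).coeff 0).natAbs ≤ M :=
      le_sup (f := fun a₂ => ((minpoly ℤ a₂).coeff 0).natAbs) h
    exact hc₀ a₂ h (Int.eq_zero_of_dvd_of_natAbs_lt_natAbs hdvd (by rw [Int.natAbs_natCast]; omega))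
  -- `r(a₂) = m_{a₂}(−p)`: not divisible by `p`, in particular nonzero
  have hr : ∀ a₂ ∈ A₂, ¬ (p : ℤ) ∣ (minpoly ℤ a₂).eval (-(p : ℤ)) := by
    intro a₂ h hdvd
    apply hpdvd a₂ h
    have hsub := sub_dvd_eval_sub (-(p : ℤ)) 0 (minpoly ℤ a₂)
    rw [sub_zero, ← coeff_zero_eq_eval_zero] at hsub
    have : (p : ℤ) ∣ (minpoly ℤ a₂).eval (-(p : ℤ)) - (minpoly ℤ a₂).coeff 0 :=
      (dvd_neg.2 dvd_rfl).trans hsub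
    exact (dvd_sub_right hdvd).1 this
  have hr0 : ∀ a₂ ∈ A₂, (minpoly ℤ a₂).eval (-(p : ℤ)) ≠ 0 :=
    fun a₂ h h0 => hr a₂ h (h0 ▸ dvd_zero _)
  -- `L' = Π r(a₂)`
  set L' : ℤ := ∏ a₂ ∈ A₂, (minpoly ℤ a₂).eval (-(p : ℤ)) with hL'
  have hL'0 : L' ≠ 0 := prod_ne_zero_iff.2 hr0
  have hpL' : ¬ (p : ℤ) ∣ L' := by
    rw [hL', hpZ.dvd_finsetProd_iff]; rintro ⟨a₂, h, hd⟩; exact hr a₂ h hd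
  -- the data
  have hp0 : (p : ℚ) ≠ 0 := by exact_mod_cast hp.ne_zero
  refine ⟨p, ⟨hp⟩, (L' : ℚ) / p, (L : ℚ) / p, ?_, div_ne_zero (Int.cast_ne_zero.2 hL'0) hp0,
    div_ne_zero (Int.cast_ne_zero.2 hL0) hp0, fun a ha => ?_⟩
  · rw [padicNorm.div, (padicNorm.int_eq_one_iff _).2 hpL', padicNorm.padicNorm_p_of_prime, one_div,
      inv_inv]
    exact_mod_cast hp.one_lt
  · have hpC : (p : ℂ) ≠ 0 := by exact_mod_cast hp.ne_zero
    have hcC : algebraMap ℚ ℂ ((L : ℚ) / p) = (L : ℂ) / p := by simp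
    have hbC : algebraMap ℚ ℂ ((L' : ℚ) / p) = (L' : ℂ) / p := by simp
    rw [hcC, hbC]
    by_cases ha0 : a = 0
    · subst ha0
      refine ⟨by simpa using div_ne_zero (Int.cast_ne_zero.2 hL0 : (L : ℂ) ≠ 0) hpC, ?_, ?_⟩
      · rw [mul_zero, zero_div]; exact isIntegral_zero
      · rw [mul_zero, zero_div, minpoly.zero, natDegree_X]; exact hp.one_lt
    · set a₂ : ℂ := (L : ℂ) * a⁻¹ with ha₂
      have ha₂A : a₂ ∈ A₂ := mem_image.2 ⟨a, mem_filter.2 ⟨ha, ha0⟩, rfl⟩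
      obtain ⟨ha₂p, hint⟩ := isIntegral_eval_div (hA₂int a₂ ha₂A).1 (p : ℤ) (hr0 a₂ ha₂A)
      push_cast at ha₂p hint
      have hden : a + (L : ℂ) / p ≠ 0 := by
        intro h
        apply ha₂p
        have : a = -((L : ℂ) / p) := eq_neg_of_add_eq_zero_left h
        rw [ha₂, this]; field_simp; ring
      have hval : (L' : ℂ) / p * a / (a + (L : ℂ) / p) =
          ((∏ a₃ ∈ A₂.erase a₂, (((minpoly ℤ a₃).eval (-(p : ℤ)) : ℤ) : ℂ)) *
            ((((minpoly ℤ a₂).eval (-(p : ℤ)) : ℤ) : ℂ) / (a₂ + (p : ℂ)))) := by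
        rw [mul_div_assoc', ← Int.cast_prod, ← Int.cast_mul, prod_erase_mul _ _ ha₂A, ← hL']
        rw [div_eq_div_iff (by simpa using hden) ha₂p, ha₂]
        field_simp
        ring
      refine ⟨hden, ?_, ?_⟩
      · rw [hval]
        refine IsIntegral.mul ?_ hint
        rw [← Int.cast_prod]; exact isIntegral_algebraMap
      · have hdeg : (minpoly ℚ a).natDegree ≤ D := le_sup (f := fun a => (minpoly ℚ a).natDegree) ha
        refine lt_of_le_of_lt
          ((natDegree_minpoly_le_of_mem_adjoin (hA a ha).isIntegral ?_).trans hdeg) (by omega)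
        have haK : a ∈ ℚ⟮a⟯ := mem_adjoin_simple_self ℚ a
        have hLp : (L : ℂ) / p ∈ ℚ⟮a⟯ := by
          have : (L : ℂ) / p = algebraMap ℚ ℂ ((L : ℚ) / p) := by simp
          rw [this]; exact IntermediateField.algebraMap_mem _ _
        have hL'p : (L' : ℂ) / p ∈ ℚ⟮a⟯ := by
          have : (L' : ℂ) / p = algebraMap ℚ ℂ ((L' : ℚ) / p) := by simp
          rw [this]; exact IntermediateField.algebraMap_mem _ _
        exact div_mem (mul_mem hL'p haK) (add_mem haK hLp)

end NoncriticalBelyi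

end Literature.NumberTheory.DiophantineGeometry
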